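import Literature.IUT.LogVolume.ArchimedeanPacketHull
import Literature.IUT.LogThetaLattice.HolomorphicHull
import HarnessLib

/-!
# [IUTchIII] Remark 3.9.5 (iv) (Ξ1^arc) in the archimedean model: `Ξ(P) ≠ ∅` at `v_ℚ ∈ 𝕍_ℚ^arc`

Mochizuki, [IUTchIII] Rmk. 3.9.5 (iv) (Ξ1), kurims p. 128: "(Ξ1) If either of the following conditions is
satisfied, then it is easily verified that `Ξ(P) ≠ ∅`: (Ξ1^non) …; (Ξ1^arc) `v_ℚ ∈ 𝕍_ℚ^arc`."  Here
`Ξ(P) := {H ∈ Hul | φ(P) ⊇ H, μ^log(H) = μ^log(P)}` (Rmk. 3.9.5 (iii), p. 128), `Preg` = direct product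
regions ("direct product of compact subsets of positive measure in each of the direct summands",
Rmk. 3.1.1 (iii), p. 95), `Hul` = hull-sets `λ·O` (Rmk. 3.9.5 (i), p. 127), `φ` = the holomorphic hull.

The layer-L6 file `Literature/IUT/LogThetaLattice/HolomorphicHull.lean` (abc-iut-L6-t4) types (Ξ1) as the
NAMED statement `LogThetaLattice.Xi1_nonempty Hul φ μlog ResidueDegreesOne IsArchimedean IsSubmoduleRegion
Preg`.  This file discharges its ARCHIMEDEAN clause (`IsArchimedean := True`, the other two predicates
arbitrary) in the tree's archimedean packet model `⊕_{j∈J} ℂ` (abc-iut-S5/S2: `ArchPacket.polydisc`,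
`ArchPacket.nlogVol` = the packet-normalised log-volume of [IUTchIII] Prop. 3.9 (i), archimedean case,
and S2's `LogVolume.holomorphicHull` for the constant family `K_j = ℂ`):

* `arch_xiApprox_nonempty` — for every direct product region `P = ∏_j A_j` (`A_j ⊆ ℂ` compact of positive
  Lebesgue measure) there is a hull-set `H = ⊕_j r_j·𝒪 ⊆ φ(P)` with `nlogVol H = nlogVol P`: take the radii
  `R_j = max_{A_j} |·|` of `φ(P)` and shrink ONE of them by the factor `exp(|J|·(nlogVol P − nlogVol φ(P)))
  ≤ 1` (archimedean radii vary CONTINUOUSLY — the feature that fails at nonarchimedean `v_ℚ`, where the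
  companion files `Xi1Model.lean` / `Xi1ModelNegative.lean` treat (Ξ1^non));
* `arch_xi1_nonempty` — the named statement `LogThetaLattice.Xi1_nonempty` HOLDS in this model.
[cite: Mochizuki2012, IUTchIII Rmk. 3.9.5 (iv) p. 128] [cite: Mochizuki2012, IUTchIII Prop. 3.9 (i) pp. 115–116]
Deliberately NOT here: unequal archimedean weights (the same one-radius adjustment works for any positive
weights, but the tree's `nlogVol` is the dimension-normalised one), any judgement on [IUTchIII] Cor. 3.12.
-/

noncomputable section

open MeasureTheory Set Metric Bornology
open scoped ENNReal Pointwise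

namespace Literature.IUT.LogVolume

namespace ArchPacket

variable (J : Type) [Fintype J] [Nonempty J]

/-- **(Ξ1^arc), core form.**  For a direct product region `P = ∏_j A_j ⊆ ⊕_j ℂ` (`A_j` compact of positive
measure) there is a hull-set `⊕_j r_j·𝒪` (`r_j > 0`) inside the holomorphic hull `φ(P)` with the same
packet-normalised log-volume as `P`. [cite: Mochizuki2012, IUTchIII Rmk. 3.9.5 (iv) p. 128] -/
theorem arch_xiApprox_nonempty {A : J → Set ℂ} (hAc : ∀ j, IsCompact (A j))
    (hApos : ∀ j, 0 < volume (A j)) :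
    ∃ r : J → ℝ, (∀ j, 0 < r j) ∧
      ArchPacket.polydisc J r ⊆ LogVolume.holomorphicHull (fun _ : J => ℂ) (Set.pi univ A) ∧
      nlogVol J (ArchPacket.polydisc J r) = nlogVol J (Set.pi univ A) := by
  classical
  have hne : ∀ j, (A j).Nonempty := fun j => nonempty_of_measure_ne_zero (hApos j).ne'
  -- maximal absolute values `R_j`, attained at `a_j ∈ A_j`
  have hmax : ∀ j, ∃ a ∈ A j, ∀ x ∈ A j, ‖x‖ ≤ ‖a‖ := fun j =>
    (hAc j).exists_isMaxOn (hne j) continuous_norm.continuousOn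
  choose a ha hamax using hmax
  set R : J → ℝ := fun j => ‖a j‖ with hRdef
  -- `R_j > 0`: otherwise `A_j ⊆ {0}` would be Lebesgue-null
  have hRpos : ∀ j, 0 < R j := by
    intro j
    by_contra h
    have hR0 : R j = 0 := le_antisymm (not_lt.mp h) (norm_nonneg _)
    have hsub : A j ⊆ {0} := fun x hx => by
      have := hamax j x hx
      rw [show ‖a j‖ = R j from rfl, hR0] at this
      exact norm_le_zero_iff.mp this
    have : volume (A j) = 0 := measure_mono_null hsub (measure_singleton _)
    exact (hApos j).ne' this
  -- the box lies in the polydisc of radii `R`, and in particular is bounded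
  have hPsub : Set.pi univ A ⊆ ArchPacket.polydisc J R := fun u hu j => hamax j (u j) (hu j (mem_univ j))
  have hPbdd : IsBounded (Set.pi univ A) := by
    rw [polydisc_eq] at hPsub
    exact (isBounded_polydisc (fun _ : J => ℂ) R).subset hPsub
  -- `polydisc R ⊆ φ(P)`: each `R_j` is attained inside the box
  choose b hb using hne
  have hmemb : ∀ j, Function.update b j (a j) ∈ Set.pi univ A := fun j i _ => by
    by_cases hij : i = j
    · subst hij; simpa using ha i
    · rw [Function.update_of_ne hij]; exact hb i
  have hRle : ∀ j, R j ≤ hullRadius (fun _ : J => ℂ) (Set.pi univ A) j := fun j => by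
    have := norm_apply_le_hullRadius (fun _ : J => ℂ) hPbdd (hmemb j) j
    simpa using this
  have hφ : LogVolume.holomorphicHull (fun _ : J => ℂ) (Set.pi univ A) =
      LogVolume.polydisc (fun _ : J => ℂ) (hullRadius (fun _ : J => ℂ) (Set.pi univ A)) :=
    holomorphicHull_of_isBounded (fun _ : J => ℂ) hPbdd
  -- volumes
  have hPvol : volume (Set.pi univ A) ≠ 0 := by
    rw [volume_pi_pi]
    exact Finset.prod_ne_zero_iff.mpr fun j _ => (hApos j).ne'
  have hδ : nlogVol J (Set.pi univ A) ≤ nlogVol J (ArchPacket.polydisc J R) :=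
    nlogVol_mono J hPsub hPvol (volume_polydisc_lt_top J R).ne
  set δ : ℝ := nlogVol J (Set.pi univ A) - nlogVol J (ArchPacket.polydisc J R) with hδdef
  have hδ0 : δ ≤ 0 := by rw [hδdef]; linarith
  -- the witness: shrink the `j₀`-th radius by `exp(|J|·δ) ≤ 1`
  obtain ⟨j₀⟩ := (inferInstance : Nonempty J)
  set r : J → ℝ := Function.update R j₀ (R j₀ * Real.exp (Fintype.card J * δ)) with hrdef
  have hrpos : ∀ j, 0 < r j := fun j => by
    by_cases hj : j = j₀
    · subst hj; simp [hrdef, hRpos, Real.exp_pos]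
    · rw [hrdef, Function.update_of_ne hj]; exact hRpos j
  have hrle : ∀ j, r j ≤ R j := fun j => by
    by_cases hj : j = j₀
    · subst hj
      simp only [hrdef, Function.update_self]
      have : Real.exp (Fintype.card J * δ) ≤ 1 :=
        Real.exp_le_one_iff.mpr (mul_nonpos_of_nonneg_of_nonpos (Nat.cast_nonneg _) hδ0)
      exact mul_le_of_le_one_right (hRpos j).le this
    · rw [hrdef, Function.update_of_ne hj]
  refine ⟨r, hrpos, ?_, ?_⟩
  · rw [hφ, polydisc_eq]
    exact polydisc_mono (fun _ : J => ℂ) fun j => (hrle j).trans (hRle j)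
  · rw [nlogVol_polydisc J hrpos]
    have hsumR := nlogVol_polydisc J hRpos
    have hJ : (Fintype.card J : ℝ) ≠ 0 := by exact_mod_cast Fintype.card_ne_zero
    -- `Σ_j log r_j = Σ_j log R_j + |J|·δ`
    have hsum : ∑ j, Real.log (r j) = ∑ j, Real.log (R j) + Fintype.card J * δ := by
      have h1 : ∑ j, Real.log (r j) =
          Real.log (r j₀) + ∑ j ∈ Finset.univ.erase j₀, Real.log (r j) :=
        (Finset.add_sum_erase _ _ (Finset.mem_univ j₀)).symm
      have h2 : ∑ j, Real.log (R j) =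
          Real.log (R j₀) + ∑ j ∈ Finset.univ.erase j₀, Real.log (R j) :=
        (Finset.add_sum_erase _ _ (Finset.mem_univ j₀)).symm
      have h3 : ∑ j ∈ Finset.univ.erase j₀, Real.log (r j) = ∑ j ∈ Finset.univ.erase j₀, Real.log (R j) :=
        Finset.sum_congr rfl fun j hj => by
          rw [hrdef, Function.update_of_ne (Finset.ne_of_mem_erase hj)]
      have h4 : Real.log (r j₀) = Real.log (R j₀) + Fintype.card J * δ := by
        simp only [hrdef, Function.update_self]
        rw [Real.log_mul (hRpos j₀).ne' (Real.exp_pos _).ne', Real.log_exp]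
      rw [h1, h2, h3, h4]
      ring
    rw [hsum, mul_add, ← hsumR, hδdef]
    field_simp
    ring

/-- **(Ξ1^arc) of [IUTchIII] Rmk. 3.9.5 (iv) HOLDS in the archimedean model** — the layer-L6 named
statement `LogThetaLattice.Xi1_nonempty` with `Hul :=` the hull-sets `⊕_j r_j·𝒪` (`r_j > 0`) of `⊕_j ℂ`,
`φ :=` S2's `holomorphicHull`, `μ^log := ArchPacket.nlogVol J`, `IsArchimedean := True` (any
`ResidueDegreesOne`, `IsSubmoduleRegion`), `Preg :=` direct product regions with compact factors of
positive Lebesgue measure. [cite: Mochizuki2012, IUTchIII Rmk. 3.9.5 (iv) p. 128] -/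
theorem arch_xi1_nonempty (ResidueDegreesOne : Prop) (IsSubmoduleRegion : Set (J → ℂ) → Prop) :
    LogThetaLattice.Xi1_nonempty
      {S : Set (J → ℂ) | ∃ r : J → ℝ, (∀ j, 0 < r j) ∧ S = ArchPacket.polydisc J r}
      (LogVolume.holomorphicHull (fun _ : J => ℂ)) (nlogVol J) ResidueDegreesOne True IsSubmoduleRegion
      {S : Set (J → ℂ) | ∃ A : J → Set ℂ, S = Set.pi univ A ∧ ∀ j, IsCompact (A j) ∧ 0 < volume (A j)} := by
  rintro P ⟨A, rfl, hA⟩ -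
  obtain ⟨r, hr, hsub, hvol⟩ := arch_xiApprox_nonempty J (fun j => (hA j).1) (fun j => (hA j).2)
  exact ⟨ArchPacket.polydisc J r, ⟨r, hr, rfl⟩, hsub, hvol⟩

end ArchPacket

end Literature.IUT.LogVolume

end
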